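import Summits.QuantumFields.YangMills.Theorems.UnitScaleTiltProp7PinnedHarmonicMass
import Summits.QuantumFields.YangMills.Theorems.UnitScaleTiltProp7FlatSubsolutionMeanValue
import Summits.QuantumFields.YangMills.Theorems.UnitScaleTiltProp7InterpErrorHarmonicLetters
import Summits.QuantumFields.YangMills.Theorems.UnitScaleTiltProp7ExactCorrectorGaugeSockets
import Literature.MathematicalPhysics.QuantumFieldTheory.Balaban1983to89.T3ContinuumYM3Torus
import HarnessLib

/-!
# Route `UnitScaleTilt`, crux K1 «MinimiserStabilityRegPr» (stmt-QuantumFields-19200), route-R E′ path (α′), (E1-b) covariant, row (hK₂-cov) — FILE «F2-cov-bulk»: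
# THE COVARIANT INTERIOR SUB-MEAN-VALUE BOUND — a matrix site field that is COVARIANTLY HARMONIC on a box ∕ `tdist`-ball of the torus `T^{(j)}`
# has `‖V(x)‖² ≤ C_d·R^{−d}·Σ_{ball} ‖V‖²` at the centre, at ANY background of norm-one units — FRAME-FREE, holonomy-blind, no smallness

Cell `ym3-torus`, width seat `ym3-torus-px11` (gen 3); LOCATE 19200 evidence #57 `LOCATE-HK2COV-px11g3.md` §1 row (BULK) («the located shortcut»); named by
routeR-w3 g6 (2026-08-28T21:47:43Z WORD (4)).  `--kind proof --supports stmt-QuantumFields-19200 --as helper`, count-neutral.  THEOREMS ONLY (0 `def`, 0 `sorry`).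
YM₃ on T³ is a ladder rung (R3) — not d = 4, not infinite volume, not a mass gap, not the Clay problem; nothing here claims the stub, the crux or the gap.

THE POINT.  px7 g3's flat (hK₂-W) chain controls `V := Δφ_H` (harmonic off the centres) pointwise in the BULK by the flat interior mean-value bound for HARMONIC functions
(✓ `Prop7FlatInteriorMeanValue.sq_le_of_harmonic`, iterated Caccioppoli on derivatives).  Covariantly (`V := Δ_Uφ_H`, `Δ_U = D^*_UD_U` at a unitary background) that road
would meet curvature commutators; it is not needed: by KATO'S INEQUALITY (✓ `Prop7PinnedHarmonicMass.norm_subMean_of_covLaplace_eq_zero`: `Δ_UV(x) = 0 ⇒ 2d‖V x‖ ≤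
Σ_μ(‖V(x+e_μ)‖ + ‖V(x−e_μ)‖)`) the scalar `z := ‖V·‖` is a NONNEGATIVE FLAT SUBSOLUTION (`laplace 1 z ≤ 0` in the positive-Laplacian sign of ✓ `LatticeFieldCalculus.laplace`)
wherever `V` is covariantly harmonic, and DE GIORGI'S sub-mean-value inequality for exactly those (✓ `Prop7FlatSubsolutionMeanValue.sq_le_of_laplace_nonpos_nonneg_torus`,
«the covariant case enters through Kato's inequality on the consumer's side») gives the `L² → L^∞` bound with the absolute constant `16·(336·d·2^d)^d`.  No frame, no `e`,
no plaquette hypothesis: the background enters only through `‖U‖ ≤ 1`, `‖U⁻¹‖ ≤ 1`.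

WHAT IS PROVED (ns `…Theorems.Prop7CovInteriorSubMeanValue`; `𝔸` a normed ring and normed `ℂ`-algebra, torus `T^{(j)}` of any `Params`, background `U` of bi-contractive units,
`Δ_Uφ x := divB (torusT P j) U (fun μ => covD (torusT P j) U μ φ) x` — the η-short letter of record).
* §1 ★ `laplace_one_norm_nonpos_of_covLaplace_eq_zero` — Kato re-lettered: `Δ_Uφ x = 0 ⇒ laplace 1 (‖φ ·‖) x ≤ 0`.
* §2 ★★ `norm_sq_le_of_covLaplace_eq_zero_on_box` — `Δ_Uφ = 0` on the pulled-back box `transl x₀ '' Q_R(0)`, `R ≥ 4` ⇒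
  `‖φ x₀‖² ≤ 16(336d2^d)^d·R^{−d}·Σ_{w∈Q_R(0)} ‖φ(transl x₀ w)‖²` (no period hypothesis);
  ★★ `norm_sq_le_of_covLaplace_eq_zero_on_ball` — the `tdist`-ball reading (`2R < N` no wrap, `d·R ≤ ρ`): `Δ_Uφ = 0` on `{tdist(·,x) ≤ ρ}` ⇒
  `‖φ x‖² ≤ 16(336d2^d)^d·R^{−d}·Σ_{tdist(z,x)≤ρ} ‖φ z‖²`; `norm_sq_le_of_covHarmonic_off_of_far` — the same for a field covariantly harmonic OFF a set `C` at a point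
  whose `ρ`-ball misses `C` (the (hK₂) BULK geometry).
* §3 ★★ `norm_sq_le_of_covLaplace_eq_zero_on_ball_T3` — the member reading: `F : T3Family`, background `unitsField (toUField W)` of an `SU(N)` field `W` (the (E1) row's
  letters, `hU` DISCHARGED by ✓ `unitsField_toUField_norm_le_one`), `d = 3`: `‖V x‖² ≤ 16·(336·3·8)³·R⁻³·Σ_{tdist(z,x)≤ρ} ‖V z‖²`.
HONEST SCOPE.  A 40-line corollary of two landed bricks ([folklore]: Kato 1972 for covariant Laplacians; De Giorgi 1957 ∕ [Giaquinta1984] Ch. III for subsolutions); the (hK₂-cov)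
far row proper (with the local mass (V-loc-cov) `Σ_{tdist≤ℓ∕2}‖Δ_Uφ_H‖² ≤ C_Vℓ³M²` from the covariant Agmon chain) is the consumer's one-liner over §2∕§3.  Nothing of Bałaban's is asserted.

References: T. Bałaban, CMP 99 (1985) 389–434 [Balaban1985BackgroundPropagators] ((3.3) p.390, (3.8) p.392); CMP 96 (1984) 223–250 [Balaban1984PropagatorsII] ((1.9) p.226);
M. Giaquinta, Princeton UP 1983 [Giaquinta1984] (Ch. III §2 (2.5) p.78).
-/

set_option autoImplicit false

noncomputable section

open scoped BigOperators

namespace Summit.QuantumFields.YangMills.Theorems.Prop7CovInteriorSubMeanValue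

open Literature.MathematicalPhysics.QuantumFieldTheory.Balaban1983to89
open Finset
open LatticeFieldCalculus (laplace)
open B9Eq39Adjoint (covD divB)
open B9TorusCalculus (torusT)
open B4Eq19LatticeOperators (Zd box)
open B10Eq27TorusAxialLog (transl transl_zero)
open Summit.QuantumFields.YangMills.Theorems.Prop7PinnedHarmonicMass (norm_subMean_of_covLaplace_eq_zero)
open Summit.QuantumFields.YangMills.Theorems.Prop7FlatSubsolutionMeanValue (sq_le_of_laplace_nonpos_nonneg_torus)
open Summit.QuantumFields.YangMills.Theorems.Prop7InterpErrorHarmonicLetters (tdist_transl_le sum_box_pullback_le_sum_ball)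

/-! ## §1 Kato re-lettered: the norm of a covariantly harmonic field is a flat subsolution -/

section Generic

variable {𝔸 : Type*} [NormedRing 𝔸] [NormedAlgebra ℂ 𝔸] {P : Params} {j : ℕ}

/-- ★ **KATO, IN THE LETTERS OF THE FLAT SUBSOLUTION BRICK**: at a background of units with `‖U‖ ≤ 1`, `‖U⁻¹‖ ≤ 1`, if `(D^*_UD_Uφ)(x) = 0` then the scalar site function
`y ↦ ‖φ y‖` satisfies `(laplace 1 ‖φ·‖)(x) = Σ_μ(2‖φ x‖ − ‖φ(x+e_μ)‖ − ‖φ(x−e_μ)‖) ≤ 0` (positive-Laplacian sign of `LatticeFieldCalculus.laplace`).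
[folklore] [cite: Balaban1985BackgroundPropagators, (3.3) p.390, (3.8) p.392] -/
theorem laplace_one_norm_nonpos_of_covLaplace_eq_zero (U : Fin P.d → Site P j → 𝔸ˣ)
    (hU : ∀ (κ : Fin P.d) (y : Site P j), ‖(U κ y : 𝔸)‖ ≤ 1 ∧ ‖(((U κ y)⁻¹ : 𝔸ˣ) : 𝔸)‖ ≤ 1)
    (φ : Site P j → 𝔸) (x : Site P j)
    (hx : divB (torusT P j) U (fun μ => covD (torusT P j) U μ φ) x = 0) :
    laplace 1 (fun y => ‖φ y‖) x ≤ 0 := by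
  have h := norm_subMean_of_covLaplace_eq_zero U hU φ x hx
  have e : laplace 1 (fun y => ‖φ y‖) x
      = ∑ μ : Fin P.d, (2 * ‖φ x‖ - (‖φ (x.shift μ)‖ + ‖φ (x.unshift μ)‖)) := by
    simp only [laplace, one_pow, one_smul]
    exact Finset.sum_congr rfl fun μ _ => by ring
  rw [e, Finset.sum_sub_distrib, Finset.sum_const, Finset.card_univ, Fintype.card_fin, nsmul_eq_mul]
  linarith

/-! ## §2 De Giorgi on the subsolution `‖φ·‖`: the covariant interior sub-mean-value bound -/

/-- ★★ **COVARIANT INTERIOR SUB-MEAN-VALUE BOUND ON A BOX** (read through the periodic pullback `transl x₀ : ℤ^d → T^{(j)}`, no period hypothesis): `d ≥ 1`, `R ≥ 4`,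
`(D^*_UD_Uφ)(transl x₀ w) = 0` for every `w ∈ Q_R(0)` ⇒ `‖φ x₀‖² ≤ 16·(336·d·2^d)^d·R^{−d}·Σ_{w ∈ Q_R(0)} ‖φ(transl x₀ w)‖²`
(Kato §1 + ✓ `Prop7FlatSubsolutionMeanValue.sq_le_of_laplace_nonpos_nonneg_torus` at `z := ‖φ·‖ ≥ 0`).
[folklore] [cite: Giaquinta1984, Ch. III §2 (2.5) p.78; Balaban1984PropagatorsII, (1.9) p.226] -/
theorem norm_sq_le_of_covLaplace_eq_zero_on_box (hd : 1 ≤ P.d) (U : Fin P.d → Site P j → 𝔸ˣ)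
    (hU : ∀ (κ : Fin P.d) (y : Site P j), ‖(U κ y : 𝔸)‖ ≤ 1 ∧ ‖(((U κ y)⁻¹ : 𝔸ˣ) : 𝔸)‖ ≤ 1)
    (φ : Site P j → 𝔸) (x₀ : Site P j) {R : ℤ} (hR : 4 ≤ R)
    (hφ : ∀ w ∈ box (0 : Zd P.d) R, divB (torusT P j) U (fun μ => covD (torusT P j) U μ φ) (transl x₀ w) = 0) :
    ‖φ x₀‖ ^ 2 ≤ 16 * (336 * (P.d : ℝ) * (2 : ℝ) ^ P.d) ^ P.d / (R : ℝ) ^ P.d * ∑ w ∈ box (0 : Zd P.d) R, ‖φ (transl x₀ w)‖ ^ 2 :=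
  sq_le_of_laplace_nonpos_nonneg_torus hd x₀ (fun y => ‖φ y‖) (fun _ => norm_nonneg _) hR
    fun w hw => laplace_one_norm_nonpos_of_covLaplace_eq_zero U hU φ _ (hφ w hw)

/-- ★★ **COVARIANT INTERIOR SUB-MEAN-VALUE BOUND ON A `tdist`-BALL**: `d ≥ 1`, `R ≥ 4`, `2R < N` (the box `x + Q_R` does not wrap), `d·R ≤ ρ`; if
`(D^*_UD_Uφ)(z) = 0` for every `z` with `tdist(z, x) ≤ ρ`, then `‖φ x‖² ≤ 16·(336·d·2^d)^d·R^{−d}·Σ_{tdist(z,x) ≤ ρ} ‖φ z‖²`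
(§2 on the box — every site of `x + Q_R` is within `tdist ≤ d·R ≤ ρ` of `x`, ✓ `tdist_transl_le` — then ✓ `sum_box_pullback_le_sum_ball`).  The covariant twin of px7's
✓ `Prop7InterpErrorHarmonicLetters.sq_le_mul_sum_ball_of_laplace_eq_zero`, with NO smallness on the background.
[folklore] [cite: Giaquinta1984, Ch. III §2 (2.5) p.78; Balaban1985BackgroundPropagators, (3.8) p.392] -/
theorem norm_sq_le_of_covLaplace_eq_zero_on_ball (hd : 1 ≤ P.d) (U : Fin P.d → Site P j → 𝔸ˣ)
    (hU : ∀ (κ : Fin P.d) (y : Site P j), ‖(U κ y : 𝔸)‖ ≤ 1 ∧ ‖(((U κ y)⁻¹ : 𝔸ˣ) : 𝔸)‖ ≤ 1)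
    (φ : Site P j → 𝔸) (x : Site P j) {R : ℕ} (hR : 4 ≤ R) (hN : 2 * R < P.sitesPerDir j) {ρ : ℝ} (hρ : (P.d : ℝ) * R ≤ ρ)
    (hφ : ∀ z : Site P j, (Site.tdist z x : ℝ) ≤ ρ → divB (torusT P j) U (fun μ => covD (torusT P j) U μ φ) z = 0) :
    ‖φ x‖ ^ 2 ≤ 16 * (336 * (P.d : ℝ) * (2 : ℝ) ^ P.d) ^ P.d / (R : ℝ) ^ P.d *
      ∑ z ∈ Finset.univ.filter (fun z : Site P j => (Site.tdist z x : ℝ) ≤ ρ), ‖φ z‖ ^ 2 := by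
  classical
  have hR' : (4 : ℤ) ≤ (R : ℤ) := by exact_mod_cast hR
  have h := norm_sq_le_of_covLaplace_eq_zero_on_box hd U hU φ x hR'
    (fun w hw => hφ _ ((tdist_transl_le x hN hw).trans hρ))
  have hcast : ((R : ℤ) : ℝ) = (R : ℝ) := by norm_cast
  rw [hcast] at h
  exact h.trans (mul_le_mul_of_nonneg_left
    (sum_box_pullback_le_sum_ball x hN hρ (fun z => ‖φ z‖ ^ 2) fun _ => sq_nonneg _) (by positivity))

/-- **THE (hK₂) BULK GEOMETRY**: a field covariantly harmonic OFF a set `C` (the pinned interpolant's `Δ_Uφ_H`, harmonic off the centres) obeys the ball bound at every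
point `x` whose `ρ`-ball misses `C`. [folklore] [cite: Balaban1985BackgroundPropagators, (3.8) p.392; Balaban1985Variational, Prop. 7 p.299] -/
theorem norm_sq_le_of_covHarmonic_off_of_far (hd : 1 ≤ P.d) (U : Fin P.d → Site P j → 𝔸ˣ)
    (hU : ∀ (κ : Fin P.d) (y : Site P j), ‖(U κ y : 𝔸)‖ ≤ 1 ∧ ‖(((U κ y)⁻¹ : 𝔸ˣ) : 𝔸)‖ ≤ 1)
    (φ : Site P j → 𝔸) (C : Set (Site P j))
    (hφ : ∀ z : Site P j, z ∉ C → divB (torusT P j) U (fun μ => covD (torusT P j) U μ φ) z = 0)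
    (x : Site P j) {R : ℕ} (hR : 4 ≤ R) (hN : 2 * R < P.sitesPerDir j) {ρ : ℝ} (hρ : (P.d : ℝ) * R ≤ ρ)
    (hfar : ∀ z : Site P j, (Site.tdist z x : ℝ) ≤ ρ → z ∉ C) :
    ‖φ x‖ ^ 2 ≤ 16 * (336 * (P.d : ℝ) * (2 : ℝ) ^ P.d) ^ P.d / (R : ℝ) ^ P.d *
      ∑ z ∈ Finset.univ.filter (fun z : Site P j => (Site.tdist z x : ℝ) ≤ ρ), ‖φ z‖ ^ 2 :=
  norm_sq_le_of_covLaplace_eq_zero_on_ball hd U hU φ x hR hN hρ fun z hz => hφ z (hfar z hz)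

end Generic

/-! ## §3 The member reading: `F : T3Family`, `SU(N)` background read through `unitsField ∘ toUField`, `d = 3` -/

section T3

open scoped Matrix.Norms.L2Operator
open Literature.MathematicalPhysics.QuantumFieldTheory.Balaban1983to89.T3ContinuumYM3Torus
open B10Eq27TorusAxialLog (unitsField toUField)
open Summit.QuantumFields.YangMills.Theorems.Prop7ExactCorrectorGaugeSockets (unitsField_toUField_norm_le_one)

/-- ★★ **COVARIANT INTERIOR SUB-MEAN-VALUE BOUND AT THE (E1) ROW'S LETTERS** (run `K` of a T³ family, `SU(N)` background `W`, `L²`-operator norm on the fibre, `d = 3`):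
`R ≥ 4`, `2R < N₀` (no wrap on the finest torus), `3R ≤ ρ`, `(D^*_WD_WV)(z) = 0` whenever `tdist(z,x) ≤ ρ` ⇒
`‖V x‖² ≤ 16·(336·3·2³)³·R⁻³·Σ_{tdist(z,x) ≤ ρ} ‖V z‖²` — the background letter `hU` discharged by ✓ `unitsField_toUField_norm_le_one`.
[folklore] [cite: Balaban1985BackgroundPropagators, (3.8) p.392; Balaban1985Variational, Prop. 7 p.299] -/
theorem norm_sq_le_of_covLaplace_eq_zero_on_ball_T3 (F : T3Family) (K : ℕ) {N : ℕ} [NeZero N]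
    (W : GaugeField (F.P K) 0 (Matrix.specialUnitaryGroup (Fin N) ℂ)) (V : Site (F.P K) 0 → Matrix (Fin N) (Fin N) ℂ)
    (x : Site (F.P K) 0) {R : ℕ} (hR : 4 ≤ R) (hN : 2 * R < (F.P K).sitesPerDir 0) {ρ : ℝ} (hρ : 3 * (R : ℝ) ≤ ρ)
    (hV : ∀ z : Site (F.P K) 0, (Site.tdist z x : ℝ) ≤ ρ →
      divB (torusT (F.P K) 0) (fun κ z => unitsField (toUField W) ⟨z, κ⟩)
        (fun μ => covD (torusT (F.P K) 0) (fun κ z => unitsField (toUField W) ⟨z, κ⟩) μ V) z = 0) :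
    ‖V x‖ ^ 2 ≤ 16 * (336 * (3 : ℝ) * (2 : ℝ) ^ 3) ^ 3 / (R : ℝ) ^ 3 *
      ∑ z ∈ Finset.univ.filter (fun z : Site (F.P K) 0 => (Site.tdist z x : ℝ) ≤ ρ), ‖V z‖ ^ 2 := by
  have hd : (F.P K).d = 3 := rfl
  have hd1 : 1 ≤ (F.P K).d := by rw [hd]; norm_num
  have hρ' : ((F.P K).d : ℝ) * R ≤ ρ := by rw [hd]; exact_mod_cast hρ
  have h := norm_sq_le_of_covLaplace_eq_zero_on_ball hd1 (fun κ z => unitsField (toUField W) ⟨z, κ⟩)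
    (fun μ z => unitsField_toUField_norm_le_one W ⟨z, μ⟩) V x hR hN hρ' hV
  rw [hd] at h
  simpa only [Nat.cast_ofNat] using h

end T3

end Summit.QuantumFields.YangMills.Theorems.Prop7CovInteriorSubMeanValue

end
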